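import Summits.ResolutionOfSingularities.ResolutionOfSingularities.Theorems.WeightedInvariantIota3CurveSigmaRatioBounds
import Summits.ResolutionOfSingularities.ResolutionOfSingularities.Theorems.WeightedInvariantIota3CurveRatioTransversal
import HarnessLib

/-!
# (CURVE-RATIO) DISCHARGED in the door's binders; gap list of record hD + (D-b³-point) + (SUCC-RATIO) for `stub_keyRungGrHomLE_three`
# (door `HypersurfaceCentreConstruction`, stmt-ResolutionOfSingularities-19897)

Helper for `stub_keyRungGrHomLE_three` (def-free, `--supports 19897`).  Assembly of …Iota3CurveRatioTransversal ((CURVE-RATIO) at a lex-max germ of a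
two-dimensional regular local ring) with …Iota3CurveSigmaRatioBounds (gap list hD + (D-b³-point) + (CURVE-RATIO) + (SUCC-RATIO)).

* **`Iota3.curveRatio_transversal`** — (CURVE-RATIO) in hand -9's binders: at a curve centre `P = (x, y) ≠ 𝔪` of a three-dimensional door
  position with `S`-presented AQS germ `(y/1, x/1; r, q; rν)`: `ν!·r ≤ sigmaRatioNat (f/1 : S_P) · q` (`dim S_P = 2`, `ord_{S_P} f = ν` on the
  top stratum, …CurveRatioTransversal).
* **`keyRungGrHomLE_three_of_tieDescent_point_succRatio`** (GAP LIST OF RECORD) and its (c11)-form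
  **`keyRungGrHomLE_three_of_c11_point_succRatio`** — `KeyRungGrHomLE 3 p ⟸` hD (resp. (c11)≤3) + (D-b³-point) [the crux, untouched] +
  **(SUCC-RATIO)**: in hand -9's binders of (D-b³-curve-FRAC-TIE-ZERO) (fractional-slope curve centre tied at `λ = 0`, any presentation, THE
  pinned `t`-homogeneous successor `𝔫 = (t⁻¹, z, W)` with its regular-threefold datum), prove
  `SuccessorRatioBound (B_𝔫) (g/1) ν q (r − q)`: **every admissible triple `(q'; r₁, r₂)` reached by a two-flag of `B_𝔫` for `g/1` has
  `r₁·q < r·r₂`** — no flag of the successor reaches the transversal slope `r/q` of the centre.  [Expected route, SIGMA-ISO.md §2 (b): a reach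
  with `r₁ > r₂` forces `in_ν(g) = c·ḡ₁^ν` (`RatContact` tangent-cone dichotomy), so `ḡ₁ = αW̄ + βT̄`; for `W`-led flags push down to the pair
  `(y − x^bφ, x)` of `S_P` and use AQS-tie-freeness `τ(S, f) = 0`; reaches with `r₁ = r₂` have `r₁·q < r·r₂` since `q < r`.]

So after hands -7…-10 the curve regime of (D-b³) for `J₃ᵗ` of record is reduced to ONE flag-slope bound at ONE explicit regular local threefold per
fractional tied curve centre; the point regime (D-b³-point) and the typing item hD are unchanged.
[OURS · L1 W4.3 · audit glue; AI work, weaker than expert review; nothing here is a statement of the manuscript under review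
(Hironaka 2017, [claim: Hironaka2017, status: under-review]).]

## References

* D. Abramovich, M. H. Quek, B. Schober, arXiv:2507.01232 (2025), Thm 1.3 (3), Thm 3.5. [AbramovichQuekSchober2025]
* D. Abramovich, M. Temkin, J. Włodarczyk, *Functorial embedded resolution via weighted blowings up*, Algebra & Number Theory 18 (2024), §5.
  [AbramovichTemkinWlodarczyk2024]
* hand -10, SIGMA-ISO.md (crux directory; OURS).
-/

noncomputable section

set_option linter.dupNamespace false -- mandated namespace of this single-conjunct summit

open IsLocalRing Literature.AlgebraicGeometry.Resolution
open Summit.ResolutionOfSingularities.ResolutionOfSingularities.Theorems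
open Summit.ResolutionOfSingularities.ResolutionOfSingularities.Theorems.ContactCylinder
open Summit.ResolutionOfSingularities.ResolutionOfSingularities.Cruxes.HypersurfaceCentreConstruction.LocalEngine.Iota3.RatContact

namespace Summit.ResolutionOfSingularities.ResolutionOfSingularities.Cruxes.HypersurfaceCentreConstruction.LocalEngine

namespace Iota3

/-- **(CURVE-RATIO) in the door's binders**: at a curve centre `P = (x, y) ≠ 𝔪` of a three-dimensional door position with `S`-presented AQS
germ `(y/1, x/1; r, q; rν)` and `f ∈ 𝔪^ν ∖ 𝔪^{ν+1}` on the top stratum `V(P)`: `ν!·r ≤ σ₁(S_P, f/1)·q`. [OURS · L1 W4.3 · (CURVE-RATIO)]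
[cite: AbramovichQuekSchober2025, Thm 3.5] -/
theorem curveRatio_transversal (p : ℕ) :
    ∀ (k₀ : Type) [Field k₀] [CharP k₀ p] [PerfectField k₀]
      (S : Type) [CommRing S] [Algebra k₀ S] [Algebra.EssFiniteType k₀ S] [IsRegularLocalRing S]
      (f : S), ringKrullDim S = 3 → f ≠ 0 → f ∈ (maximalIdeal S) ^ 2 →
      ∀ (P : Ideal S) [P.IsPrime], IsRegularLocalRing (S ⧸ P) → f ∈ P →
        topStratum iotaOrdEpsTau S f = {𝔮 | P ≤ 𝔮.asIdeal} → ¬ ringKrullDim (Localization.AtPrime P) ≤ 1 →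
        P ≠ maximalIdeal S →
        ∀ (x y z : S) (q r ν : ℕ) (_ : (Ideal.span ({x, y} : Set S)).IsPrime), Ideal.span {x, y, z} = maximalIdeal S →
          P = Ideal.span {x, y} → 2 ≤ q → q ≤ r → 1 ≤ ν → f ∈ maximalIdeal S ^ ν → f ∉ maximalIdeal S ^ (ν + 1) →
          IsLexMaxWeightedCentreGerm (Localization.AtPrime (Ideal.span ({x, y} : Set S)))
            (Ideal.span {algebraMap S (Localization.AtPrime (Ideal.span ({x, y} : Set S))) f})
            ![algebraMap S (Localization.AtPrime (Ideal.span ({x, y} : Set S))) y,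
              algebraMap S (Localization.AtPrime (Ideal.span ({x, y} : Set S))) x] ![r, q] (r * ν) →
          ratioScale ν * r ≤ sigmaRatioNat (algebraMap S (Localization.AtPrime P) f) * q := by
  intro k₀ _ _ _ S _ _ _ _ f hd _ _ P _ _ _ hE hP1 hPm x y _ q r ν _ _ hPeq _ _ hν1 hfν hfν1 hlex
  haveI : IsRegularLocalRing (Localization.AtPrime P) := isRegularLocalRing_localization_atPrime S P
  have hdimA : ringKrullDim (Localization.AtPrime P) = (2 : ℕ) := ringKrullDim_localization_eq_two_of_curveCentre hd P hP1 hPm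
  obtain ⟨_, hlex'⟩ := exists_isLexMax_of_eq hPeq.symm hlex
  have hιP : iotaOrd (Localization.AtPrime P) (algebraMap S (Localization.AtPrime P) f) = iotaOrd S f := by
    have hmem : (⟨P, ‹_›⟩ : PrimeSpectrum S) ∈ topStratum iotaOrdEpsTau S f := by
      rw [hE]
      exact (le_rfl : P ≤ P)
    have h0 : iotaOrdEpsTau (Localization.AtPrime P) (algebraMap S (Localization.AtPrime P) f) = iotaOrdEpsTau S f := hmem
    exact ((iotaOrdEps_eq_iff _ _ _ _).mp ((iotaOrdEpsTau_eq_iff _ _ _ _).mp h0).1).1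
  rw [(iotaOrd_eq_natCast_iff S f ν).mpr ⟨hfν, hfν1⟩] at hιP
  obtain ⟨hfPν, hfPν1⟩ := (iotaOrd_eq_natCast_iff (Localization.AtPrime P) (algebraMap S (Localization.AtPrime P) f) ν).mp hιP
  exact ratioScale_mul_le_sigmaRatioNat_mul_of_isLexMax hdimA hν1 hfPν hfPν1 hlex'

end Iota3

open Iota3

/-- **GAP LIST OF RECORD for `stub_keyRungGrHomLE_three` — hD + (D-b³-point) + (SUCC-RATIO)** (module docstring): the curve regime of (D-b³)
costs exactly the successor ratio bound «no two-flag of `B_𝔫` reaches the transversal slope `r/q` for `g/1`» at the pinned regular local threefold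
per fractional tied curve centre. [OURS · L1 W4.3 · audit glue] -/
theorem keyRungGrHomLE_three_of_tieDescent_point_succRatio (p : ℕ)
    (hD : ∀ (T T' : Type) [CommRing T] [IsRegularLocalRing T] [CommRing T'] [IsRegularLocalRing T'] [Algebra T T']
      [IsLocalHom (algebraMap T T')] [Algebra.FormallySmooth T T'] [Algebra.EssFiniteType T T'] (g : T),
      ringKrullDim T' ≤ 3 → IsTiePosition T' (algebraMap T T' g) → IsTiePosition T g)
    (hPOINT : ∀ (k₀ : Type) [Field k₀] [CharP k₀ p] [PerfectField k₀]
      (S : Type) [CommRing S] [Algebra k₀ S] [Algebra.EssFiniteType k₀ S] [IsRegularLocalRing S]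
      (f : S), ringKrullDim S = 3 → f ≠ 0 → f ∈ (maximalIdeal S) ^ 2 →
      ∀ (P : Ideal S) [P.IsPrime], IsRegularLocalRing (S ⧸ P) → f ∈ P →
        topStratum iotaOrdEpsTau S f = {𝔮 | P ≤ 𝔮.asIdeal} → ¬ ringKrullDim (Localization.AtPrime P) ≤ 1 →
        P = maximalIdeal S →
        ∀ (n : ℕ) (u : Fin n → S) (w : Fin n → ℕ),
          Ideal.span (Set.range u) = maximalIdeal S → (maximalIdeal S).spanFinrank = n → (∃ i, 0 < w i) →
          Ideal.span {x | ∃ i, 0 < w i ∧ x = u i} = P →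
          (∀ m : ℕ, weightedMonomialIdeal u w m = jFlatT S f m) →
          ∀ (𝔫 : Ideal (cobordantAlgebra' u w)) [𝔫.IsPrime], IsTHomogeneous u w 𝔫 → cobordantT' u w ∈ 𝔫 →
            (maximalIdeal S).map (algebraMap S (cobordantAlgebra' u w)) ≤ 𝔫 →
            ¬ extReesAlgebra.vertexIdeal (weightedMonomialIdeal u w) ≤ 𝔫 →
            ∀ (a : ℕ) (g : cobordantAlgebra' u w), algebraMap S (cobordantAlgebra' u w) f = cobordantT' u w ^ a * g →
              ¬ cobordantT' u w ∣ g →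
              algebraMap (cobordantAlgebra' u w) (Localization.AtPrime 𝔫) g ∈ maximalIdeal (Localization.AtPrime 𝔫) ^ 2 →
              iotaFlatT (Localization.AtPrime 𝔫) (algebraMap (cobordantAlgebra' u w) (Localization.AtPrime 𝔫) g) <
                iotaFlatT S f)
    (hSUCC : ∀ (k₀ : Type) [Field k₀] [CharP k₀ p] [PerfectField k₀]
      (S : Type) [CommRing S] [Algebra k₀ S] [Algebra.EssFiniteType k₀ S] [IsRegularLocalRing S]
      (f : S), ringKrullDim S = 3 → f ≠ 0 → f ∈ (maximalIdeal S) ^ 2 →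
      ∀ (P : Ideal S) [P.IsPrime], IsRegularLocalRing (S ⧸ P) → f ∈ P →
        topStratum iotaOrdEpsTau S f = {𝔮 | P ≤ 𝔮.asIdeal} → ¬ ringKrullDim (Localization.AtPrime P) ≤ 1 →
        P ≠ maximalIdeal S →
        ∀ (x y z : S) (q r ν : ℕ) (_ : (Ideal.span ({x, y} : Set S)).IsPrime), Ideal.span {x, y, z} = maximalIdeal S →
          P = Ideal.span {x, y} → 2 ≤ q → q ≤ r → 1 ≤ ν → f ∈ maximalIdeal S ^ ν → f ∉ maximalIdeal S ^ (ν + 1) →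
          IsLexMaxWeightedCentreGerm (Localization.AtPrime (Ideal.span ({x, y} : Set S)))
            (Ideal.span {algebraMap S (Localization.AtPrime (Ideal.span ({x, y} : Set S))) f})
            ![algebraMap S (Localization.AtPrime (Ideal.span ({x, y} : Set S))) y,
              algebraMap S (Localization.AtPrime (Ideal.span ({x, y} : Set S))) x] ![r, q] (r * ν) →
          1 ≤ r / q → f ∈ weightedMonomialIdeal ![y, x] ![r / q, 1] (r / q * ν) →
          (∀ m : ℕ, jFlatT S f m = weightedMonomialIdeal ![y, x] ![r / q, 1] m) →
        ∀ (n : ℕ) (u : Fin n → S) (w : Fin n → ℕ),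
          Ideal.span (Set.range u) = maximalIdeal S → (maximalIdeal S).spanFinrank = n → (∃ i, 0 < w i) →
          Ideal.span {x | ∃ i, 0 < w i ∧ x = u i} = P →
          (∀ m : ℕ, weightedMonomialIdeal u w m = jFlatT S f m) →
          ∀ (𝔫 : Ideal (cobordantAlgebra' u w)) [𝔫.IsPrime], IsTHomogeneous u w 𝔫 → cobordantT' u w ∈ 𝔫 →
            (maximalIdeal S).map (algebraMap S (cobordantAlgebra' u w)) ≤ 𝔫 →
            ¬ extReesAlgebra.vertexIdeal (weightedMonomialIdeal u w) ≤ 𝔫 →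
            ∀ (a : ℕ) (g : cobordantAlgebra' u w), algebraMap S (cobordantAlgebra' u w) f = cobordantT' u w ^ a * g →
              ¬ cobordantT' u w ∣ g →
              algebraMap (cobordantAlgebra' u w) (Localization.AtPrime 𝔫) g ∈ maximalIdeal (Localization.AtPrime 𝔫) ^ 2 →
              f ∈ weightedMonomialIdeal ![x, y, z] ![1, r / q + 1, 1] ((r / q + 1) * ν) →
              ∀ W : cobordantAlgebra' u w, algebraMap S (cobordantAlgebra' u w) y = cobordantT' u w ^ (r / q) * W →
                𝔫 = Ideal.span {cobordantT' u w, algebraMap S (cobordantAlgebra' u w) z, W} →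
                IsRegularLocalRing (Localization.AtPrime 𝔫) → ringKrullDim (Localization.AtPrime 𝔫) = (3 : ℕ) →
                Ideal.span {algebraMap _ (Localization.AtPrime 𝔫) (cobordantT' u w),
                  algebraMap _ (Localization.AtPrime 𝔫) (algebraMap S (cobordantAlgebra' u w) z),
                  algebraMap _ (Localization.AtPrime 𝔫) W} = maximalIdeal (Localization.AtPrime 𝔫) →
              SuccessorRatioBound (Localization.AtPrime 𝔫) (algebraMap (cobordantAlgebra' u w) (Localization.AtPrime 𝔫) g) ν q (r - q))
    : KeyRungGrHomLE 3 p :=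
  keyRungGrHomLE_three_of_tieDescent_point_ratioBounds p hD hPOINT (curveRatio_transversal p) hSUCC

/-- **GAP LIST OF RECORD, (c11)-form — (c11)≤3 + (D-b³-point) + (SUCC-RATIO).** [OURS · L1 W4.3 · audit glue] -/
theorem keyRungGrHomLE_three_of_c11_point_succRatio (p : ℕ) (hc11 : IotaJEssSmoothCompatibleLE 3 iotaFlatT jFlatT)
    (hPOINT : ∀ (k₀ : Type) [Field k₀] [CharP k₀ p] [PerfectField k₀]
      (S : Type) [CommRing S] [Algebra k₀ S] [Algebra.EssFiniteType k₀ S] [IsRegularLocalRing S]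
      (f : S), ringKrullDim S = 3 → f ≠ 0 → f ∈ (maximalIdeal S) ^ 2 →
      ∀ (P : Ideal S) [P.IsPrime], IsRegularLocalRing (S ⧸ P) → f ∈ P →
        topStratum iotaOrdEpsTau S f = {𝔮 | P ≤ 𝔮.asIdeal} → ¬ ringKrullDim (Localization.AtPrime P) ≤ 1 →
        P = maximalIdeal S →
        ∀ (n : ℕ) (u : Fin n → S) (w : Fin n → ℕ),
          Ideal.span (Set.range u) = maximalIdeal S → (maximalIdeal S).spanFinrank = n → (∃ i, 0 < w i) →
          Ideal.span {x | ∃ i, 0 < w i ∧ x = u i} = P →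
          (∀ m : ℕ, weightedMonomialIdeal u w m = jFlatT S f m) →
          ∀ (𝔫 : Ideal (cobordantAlgebra' u w)) [𝔫.IsPrime], IsTHomogeneous u w 𝔫 → cobordantT' u w ∈ 𝔫 →
            (maximalIdeal S).map (algebraMap S (cobordantAlgebra' u w)) ≤ 𝔫 →
            ¬ extReesAlgebra.vertexIdeal (weightedMonomialIdeal u w) ≤ 𝔫 →
            ∀ (a : ℕ) (g : cobordantAlgebra' u w), algebraMap S (cobordantAlgebra' u w) f = cobordantT' u w ^ a * g →
              ¬ cobordantT' u w ∣ g →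
              algebraMap (cobordantAlgebra' u w) (Localization.AtPrime 𝔫) g ∈ maximalIdeal (Localization.AtPrime 𝔫) ^ 2 →
              iotaFlatT (Localization.AtPrime 𝔫) (algebraMap (cobordantAlgebra' u w) (Localization.AtPrime 𝔫) g) <
                iotaFlatT S f)
    (hSUCC : ∀ (k₀ : Type) [Field k₀] [CharP k₀ p] [PerfectField k₀]
      (S : Type) [CommRing S] [Algebra k₀ S] [Algebra.EssFiniteType k₀ S] [IsRegularLocalRing S]
      (f : S), ringKrullDim S = 3 → f ≠ 0 → f ∈ (maximalIdeal S) ^ 2 →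
      ∀ (P : Ideal S) [P.IsPrime], IsRegularLocalRing (S ⧸ P) → f ∈ P →
        topStratum iotaOrdEpsTau S f = {𝔮 | P ≤ 𝔮.asIdeal} → ¬ ringKrullDim (Localization.AtPrime P) ≤ 1 →
        P ≠ maximalIdeal S →
        ∀ (x y z : S) (q r ν : ℕ) (_ : (Ideal.span ({x, y} : Set S)).IsPrime), Ideal.span {x, y, z} = maximalIdeal S →
          P = Ideal.span {x, y} → 2 ≤ q → q ≤ r → 1 ≤ ν → f ∈ maximalIdeal S ^ ν → f ∉ maximalIdeal S ^ (ν + 1) →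
          IsLexMaxWeightedCentreGerm (Localization.AtPrime (Ideal.span ({x, y} : Set S)))
            (Ideal.span {algebraMap S (Localization.AtPrime (Ideal.span ({x, y} : Set S))) f})
            ![algebraMap S (Localization.AtPrime (Ideal.span ({x, y} : Set S))) y,
              algebraMap S (Localization.AtPrime (Ideal.span ({x, y} : Set S))) x] ![r, q] (r * ν) →
          1 ≤ r / q → f ∈ weightedMonomialIdeal ![y, x] ![r / q, 1] (r / q * ν) →
          (∀ m : ℕ, jFlatT S f m = weightedMonomialIdeal ![y, x] ![r / q, 1] m) →
        ∀ (n : ℕ) (u : Fin n → S) (w : Fin n → ℕ),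
          Ideal.span (Set.range u) = maximalIdeal S → (maximalIdeal S).spanFinrank = n → (∃ i, 0 < w i) →
          Ideal.span {x | ∃ i, 0 < w i ∧ x = u i} = P →
          (∀ m : ℕ, weightedMonomialIdeal u w m = jFlatT S f m) →
          ∀ (𝔫 : Ideal (cobordantAlgebra' u w)) [𝔫.IsPrime], IsTHomogeneous u w 𝔫 → cobordantT' u w ∈ 𝔫 →
            (maximalIdeal S).map (algebraMap S (cobordantAlgebra' u w)) ≤ 𝔫 →
            ¬ extReesAlgebra.vertexIdeal (weightedMonomialIdeal u w) ≤ 𝔫 →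
            ∀ (a : ℕ) (g : cobordantAlgebra' u w), algebraMap S (cobordantAlgebra' u w) f = cobordantT' u w ^ a * g →
              ¬ cobordantT' u w ∣ g →
              algebraMap (cobordantAlgebra' u w) (Localization.AtPrime 𝔫) g ∈ maximalIdeal (Localization.AtPrime 𝔫) ^ 2 →
              f ∈ weightedMonomialIdeal ![x, y, z] ![1, r / q + 1, 1] ((r / q + 1) * ν) →
              ∀ W : cobordantAlgebra' u w, algebraMap S (cobordantAlgebra' u w) y = cobordantT' u w ^ (r / q) * W →
                𝔫 = Ideal.span {cobordantT' u w, algebraMap S (cobordantAlgebra' u w) z, W} →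
                IsRegularLocalRing (Localization.AtPrime 𝔫) → ringKrullDim (Localization.AtPrime 𝔫) = (3 : ℕ) →
                Ideal.span {algebraMap _ (Localization.AtPrime 𝔫) (cobordantT' u w),
                  algebraMap _ (Localization.AtPrime 𝔫) (algebraMap S (cobordantAlgebra' u w) z),
                  algebraMap _ (Localization.AtPrime 𝔫) W} = maximalIdeal (Localization.AtPrime 𝔫) →
              SuccessorRatioBound (Localization.AtPrime 𝔫) (algebraMap (cobordantAlgebra' u w) (Localization.AtPrime 𝔫) g) ν q (r - q))
    : KeyRungGrHomLE 3 p :=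
  keyRungGrHomLE_three_of_c11_point_ratioBounds p hc11 hPOINT (curveRatio_transversal p) hSUCC

end Summit.ResolutionOfSingularities.ResolutionOfSingularities.Cruxes.HypersurfaceCentreConstruction.LocalEngine

end
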